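import Mathlib
import Literature.Computability.Cryptography.ModExpCircuits

/-!
# `FeketeSOS.SOSMagnification` (stmt-ValiantsHypothesis-3995), line `sml-polarised-transport` —
# stub C2 `stub_oneHotLtCircuit`: the one-hot validity and `m < p` comparison circuit

For `p < k ^ n` we build a fan-in-two Boolean circuit `G` over `B₂` on the `n · k` inputs
`x (j, i)` (`j < n` a block = a base-`k` digit position, `i < k` a digit value), of size
`≤ 16 · ((n+1)(k+1))^16`, such that

* `G x = true` only if `x` is ONE-HOT (every block `j` carries exactly one true wire), i.e.
  `x = fun v => decide (d v.1 = v.2)` for a digit vector `d : Fin n → Fin k`;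
* on the one-hot encoding of `d`, `G` decides `m(d) = Σ_j d_j k^j < p`.

Construction (school method), entirely inside the bus calculus `CktSizeVia` of
`Literature/Computability/AlgebraicComplexity/BurgisserBooleanPartsModPCircuits.lean`, read on the
IDENTITY bus so that `CktSizeVia.toCktSize` returns a genuine circuit that is correct on ALL inputs:
`G x = OH x ∧ LEX x`, where `OH x = ⋀_j ((⋁_i x(j,i)) ∧ ⋀_{i,i'} ([i = i'] ∨ ¬(x(j,i) ∧ x(j,i'))))`
(OR-folds, rows of binary gates, AND-folds) and, with `pd` the base-`k` digit vector of `p`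
(`finFunctionFinEquiv.symm p`), `LEX x = ⋁_j ((⋁_{i < pd j} x(j,i)) ∧ ⋀_{j' > j} x(j', pd j'))`.
On a one-hot input `LEX` is the most-significant-digit-first lexicographic test
`∃ j, d_j < pd_j ∧ ∀ j' > j, d_{j'} = pd_{j'}`, which is `m(d) < m(pd) = p`
(`oneHotLt_lex_iff`, induction on `n` splitting off the top digit).

No definitions are introduced: the Boolean tests are written as explicit `List.any` / `List.all`
folds over `Finset.toList` enumerations. Everything is proved; no named facts are used. [folklore]
-/

-- `Summit.ValiantsHypothesis.ValiantsHypothesis.…` is the tree's mandated single-conjunct layout (Sub = Summit).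
set_option linter.dupNamespace false

namespace Summit.ValiantsHypothesis.ValiantsHypothesis.Theorems.FeketeSOSSOSMagnification

open Literature.Computability.AlgebraicComplexity
open Literature.Computability.Complexity (CktSize B2 cktSize_const)

/-! ### Arithmetic: base-`k` digit vectors compare lexicographically, top digit first -/

/-- A base-`k` digit vector of length `n` encodes a number `< k ^ n`. [folklore] -/
theorem oneHotLt_sum_lt (k n : ℕ) (d : Fin n → Fin k) :
    ∑ j : Fin n, (d j : ℕ) * k ^ (j : ℕ) < k ^ n := by
  have h := (finFunctionFinEquiv d).isLt
  rwa [finFunctionFinEquiv_apply] at h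

/-- Carry step: with a low part `< K`, a smaller top digit gives a smaller number. [folklore] -/
theorem oneHotLt_carry {D E a b K : ℕ} (hD : D < K) (hab : a < b) : D + a * K < E + b * K := by
  have h1 : (a + 1) * K ≤ b * K := Nat.mul_le_mul_right K (Nat.succ_le_of_lt hab)
  have h2 : (a + 1) * K = a * K + K := by ring
  omega

/-- Comparison of `D + a K` with `E + b K` for low parts `D, E < K`: top digit first. [folklore] -/
theorem oneHotLt_digit_step {D E a b K : ℕ} (hD : D < K) (hE : E < K) :
    D + a * K < E + b * K ↔ a < b ∨ (a = b ∧ D < E) := by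
  constructor
  · intro h
    rcases lt_trichotomy a b with hab | rfl | hab
    · exact Or.inl hab
    · exact Or.inr ⟨rfl, by omega⟩
    · exact absurd h (not_lt.mpr (oneHotLt_carry hE hab).le)
  · rintro (hab | ⟨rfl, h⟩)
    · exact oneHotLt_carry hD hab
    · omega

/-- **Lexicographic comparison of base-`k` expansions** (most significant digit = largest index):
`Σ_j d_j k^j < Σ_j e_j k^j ↔ ∃ j, d_j < e_j ∧ ∀ j' > j, d_{j'} = e_{j'}`. [folklore] -/
theorem oneHotLt_lex_iff (k : ℕ) : ∀ (n : ℕ) (d e : Fin n → Fin k),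
    (∑ j : Fin n, (d j : ℕ) * k ^ (j : ℕ) < ∑ j : Fin n, (e j : ℕ) * k ^ (j : ℕ)) ↔
      ∃ j : Fin n, d j < e j ∧ ∀ j' : Fin n, j < j' → d j' = e j'
  | 0, d, e => by simp
  | n + 1, d, e => by
    have hD := oneHotLt_sum_lt k n fun j => d j.castSucc
    have hE := oneHotLt_sum_lt k n fun j => e j.castSucc
    have ih := oneHotLt_lex_iff k n (fun j => d j.castSucc) fun j => e j.castSucc
    have hlast : (∀ j' : Fin (n + 1), Fin.last n < j' → d j' = e j') ↔ True :=
      iff_true_intro fun j' h => absurd h (not_lt.mpr (Fin.le_last j'))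
    rw [Fin.sum_univ_castSucc, Fin.sum_univ_castSucc]
    simp only [Fin.val_castSucc, Fin.val_last]
    refine (oneHotLt_digit_step hD hE).trans ?_
    rw [ih, Fin.exists_fin_succ', hlast]
    simp only [and_true, Fin.forall_fin_succ', Fin.castSucc_lt_castSucc_iff, Fin.castSucc_lt_last,
      true_implies]
    simp only [Fin.lt_def, Fin.ext_iff]
    constructor
    · rintro (h | ⟨hb, j, hj, hj'⟩)
      · exact Or.inr h
      · exact Or.inl ⟨j, hj, hj', hb⟩
    · rintro (⟨j, hj, hj', hb⟩ | h)
      · exact Or.inr ⟨hb, j, hj, hj'⟩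
      · exact Or.inl h

/-! ### Circuit gadgets on a bus: OR-folds, AND-folds, the conjunction of two programs -/

section Gadgets

variable {θ α β : Type*}

/-- **OR-fold on a bus**: `⋁_{b ∈ ws} a (π b)` by one binary gate per listed wire (plus the initial
constant), cf. `CktSizeVia.maskedParity`. [folklore] -/
theorem oneHotLt_anyVia (e : θ → α → Bool) (π : β → α) :
    ∀ ws : List β, CktSizeVia e (fun t (_ : Unit) => ws.any fun b => e t (π b)) (ws.length + 1)
  | [] => CktSizeVia.of_cktSize (cktSize_const α false) fun _ => rfl
  | w :: ws => by
    have h := ((oneHotLt_anyVia e π ws).extend).trans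
      (CktSizeVia.binop (fun t => Sum.elim (e t) (fun _ : Unit => ws.any fun b => e t (π b)))
        (fun x y => x || y) (Sum.inl (π w)) (Sum.inr ()))
    refine (h.congr fun t => ?_).of_le (by simp)
    funext u
    simp

/-- **AND-fold on a bus**: `⋀_{b ∈ ws} a (π b)` by one binary gate per listed wire (plus the initial
constant), cf. `CktSizeVia.allMatch`. [folklore] -/
theorem oneHotLt_allVia (e : θ → α → Bool) (π : β → α) :
    ∀ ws : List β, CktSizeVia e (fun t (_ : Unit) => ws.all fun b => e t (π b)) (ws.length + 1)
  | [] => CktSizeVia.of_cktSize (cktSize_const α true) fun _ => rfl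
  | w :: ws => by
    have h := ((oneHotLt_allVia e π ws).extend).trans
      (CktSizeVia.binop (fun t => Sum.elim (e t) (fun _ : Unit => ws.all fun b => e t (π b)))
        (fun x y => x && y) (Sum.inl (π w)) (Sum.inr ()))
    refine (h.congr fun t => ?_).of_le (by simp)
    funext u
    simp

/-- The conjunction of two single-output programs on the same bus: sizes add, plus one gate. [folklore] -/
theorem oneHotLt_andVia {e : θ → α → Bool} {f g : θ → Bool} {s s' : ℕ}
    (hf : CktSizeVia e (fun t (_ : Unit) => f t) s) (hg : CktSizeVia e (fun t (_ : Unit) => g t) s') :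
    CktSizeVia e (fun t (_ : Unit) => f t && g t) (s + s' + 1) :=
  ((hf.pair hg).trans (CktSizeVia.binop _ (fun x y => x && y) (Sum.inl ()) (Sum.inr ()))).congr
    fun _ => rfl

end Gadgets

/-! ### The one-hot test `OH` -/

/-- Block `j` has at least one true wire: an OR-fold over the block, `k + 1` gates. [folklore] -/
theorem oneHotLt_al1Via (n k : ℕ) (j : Fin n) :
    CktSizeVia (fun x : (Fin n × Fin k → Bool) => x)
      (fun x (_ : Unit) => (Finset.univ : Finset (Fin k)).toList.any fun i => x (j, i)) (k + 1) := by
  refine (oneHotLt_anyVia (fun x : (Fin n × Fin k → Bool) => x) (fun i : Fin k => (j, i))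
    (Finset.univ : Finset (Fin k)).toList).of_le ?_
  simp [Finset.length_toList]

/-- Block `j` has at most one true wire: a row of `k²` gates `[i = i'] ∨ ¬(x(j,i) ∧ x(j,i'))`
followed by an AND-fold, `k² + (k² + 1)` gates. [folklore] -/
theorem oneHotLt_exclVia (n k : ℕ) (j : Fin n) :
    CktSizeVia (fun x : (Fin n × Fin k → Bool) => x)
      (fun x (_ : Unit) => (Finset.univ : Finset (Fin k × Fin k)).toList.all fun ii =>
        decide (ii.1 = ii.2) || !(x (j, ii.1) && x (j, ii.2)))
      (k * k + (k * k + 1)) := by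
  have h1 : CktSizeVia (fun x : (Fin n × Fin k → Bool) => x)
      (fun x (ii : Fin k × Fin k) => decide (ii.1 = ii.2) || !(x (j, ii.1) && x (j, ii.2)))
      (Fintype.card (Fin k × Fin k) * 1) :=
    CktSizeVia.pi_const fun ii =>
      CktSizeVia.binop _ (fun a b => decide (ii.1 = ii.2) || !(a && b)) (j, ii.1) (j, ii.2)
  refine (h1.trans (oneHotLt_allVia _ (fun ii : Fin k × Fin k => ii)
    (Finset.univ : Finset (Fin k × Fin k)).toList)).of_le ?_
  simp [Finset.length_toList]

/-- The one-hot test of block `j`: at least one and at most one true wire. [folklore] -/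
theorem oneHotLt_blockVia (n k : ℕ) (j : Fin n) :
    CktSizeVia (fun x : (Fin n × Fin k → Bool) => x)
      (fun x (_ : Unit) =>
        ((Finset.univ : Finset (Fin k)).toList.any fun i => x (j, i)) &&
        (Finset.univ : Finset (Fin k × Fin k)).toList.all fun ii =>
          decide (ii.1 = ii.2) || !(x (j, ii.1) && x (j, ii.2)))
      (k + 1 + (k * k + (k * k + 1)) + 1) :=
  oneHotLt_andVia (oneHotLt_al1Via n k j) (oneHotLt_exclVia n k j)

/-- **The one-hot test** `OH x = ⋀_j (block test j)`: `n` block tests and an AND-fold. [folklore] -/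
theorem oneHotLt_ohVia (n k : ℕ) :
    CktSizeVia (fun x : (Fin n × Fin k → Bool) => x)
      (fun x (_ : Unit) => (Finset.univ : Finset (Fin n)).toList.all fun j =>
        ((Finset.univ : Finset (Fin k)).toList.any fun i => x (j, i)) &&
        (Finset.univ : Finset (Fin k × Fin k)).toList.all fun ii =>
          decide (ii.1 = ii.2) || !(x (j, ii.1) && x (j, ii.2)))
      (n * (k + 1 + (k * k + (k * k + 1)) + 1) + (n + 1)) := by
  have h1 : CktSizeVia (fun x : (Fin n × Fin k → Bool) => x)
      (fun x (j : Fin n) =>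
        ((Finset.univ : Finset (Fin k)).toList.any fun i => x (j, i)) &&
        (Finset.univ : Finset (Fin k × Fin k)).toList.all fun ii =>
          decide (ii.1 = ii.2) || !(x (j, ii.1) && x (j, ii.2)))
      (Fintype.card (Fin n) * (k + 1 + (k * k + (k * k + 1)) + 1)) :=
    CktSizeVia.pi_const fun j => oneHotLt_blockVia n k j
  refine (h1.trans (oneHotLt_allVia _ (fun j : Fin n => j)
    (Finset.univ : Finset (Fin n)).toList)).of_le ?_
  simp [Finset.length_toList]

/-! ### The comparison test `LEX` against hard-wired digits `c` -/

/-- Digit test of block `j` against `c`: (some wire `i < c j` of block `j` is true) and (every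
later block `j' > j` has its wire `c j'` true); `(k+1) + (n+1) + 1` gates. [folklore] -/
theorem oneHotLt_ltBlockVia (n k : ℕ) (c : Fin n → Fin k) (j : Fin n) :
    CktSizeVia (fun x : (Fin n × Fin k → Bool) => x)
      (fun x (_ : Unit) =>
        ((Finset.univ.filter fun i : Fin k => i < c j).toList.any fun i => x (j, i)) &&
        (Finset.univ.filter fun j' : Fin n => j < j').toList.all fun j' => x (j', c j'))
      (k + 1 + (n + 1) + 1) := by
  refine oneHotLt_andVia
    ((oneHotLt_anyVia (fun x : (Fin n × Fin k → Bool) => x) (fun i : Fin k => (j, i))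
      (Finset.univ.filter fun i : Fin k => i < c j).toList).of_le ?_)
    ((oneHotLt_allVia (fun x : (Fin n × Fin k → Bool) => x) (fun j' : Fin n => (j', c j'))
      (Finset.univ.filter fun j' : Fin n => j < j').toList).of_le ?_)
  · rw [Finset.length_toList]
    exact Nat.add_le_add_right ((Finset.card_filter_le _ _).trans (by simp)) 1
  · rw [Finset.length_toList]
    exact Nat.add_le_add_right ((Finset.card_filter_le _ _).trans (by simp)) 1

/-- **The comparison test** `LEX x = ⋁_j (digit test j)`: `n` digit tests and an OR-fold. [folklore] -/
theorem oneHotLt_lexVia (n k : ℕ) (c : Fin n → Fin k) :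
    CktSizeVia (fun x : (Fin n × Fin k → Bool) => x)
      (fun x (_ : Unit) => (Finset.univ : Finset (Fin n)).toList.any fun j =>
        ((Finset.univ.filter fun i : Fin k => i < c j).toList.any fun i => x (j, i)) &&
        (Finset.univ.filter fun j' : Fin n => j < j').toList.all fun j' => x (j', c j'))
      (n * (k + 1 + (n + 1) + 1) + (n + 1)) := by
  have h1 : CktSizeVia (fun x : (Fin n × Fin k → Bool) => x)
      (fun x (j : Fin n) =>
        ((Finset.univ.filter fun i : Fin k => i < c j).toList.any fun i => x (j, i)) &&
        (Finset.univ.filter fun j' : Fin n => j < j').toList.all fun j' => x (j', c j'))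
      (Fintype.card (Fin n) * (k + 1 + (n + 1) + 1)) :=
    CktSizeVia.pi_const fun j => oneHotLt_ltBlockVia n k c j
  refine (h1.trans (oneHotLt_anyVia _ (fun j : Fin n => j)
    (Finset.univ : Finset (Fin n)).toList)).of_le ?_
  simp [Finset.length_toList]

/-- The total gate count is polynomial: `≤ 16 · ((n+1)(k+1))^16`. [folklore] -/
theorem oneHotLt_cost_le (n k : ℕ) :
    n * (k + 1 + (k * k + (k * k + 1)) + 1) + (n + 1) + (n * (k + 1 + (n + 1) + 1) + (n + 1)) + 1 ≤
      16 * ((n + 1) * (k + 1)) ^ 16 := by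
  set M := (n + 1) * (k + 1) with hM
  have hM1 : 1 ≤ M := Nat.mul_pos (Nat.succ_pos n) (Nat.succ_pos k)
  have hn : n ≤ M := (Nat.le_succ n).trans (Nat.le_mul_of_pos_right _ (Nat.succ_pos k))
  have hk : k ≤ M := (Nat.le_succ k).trans (Nat.le_mul_of_pos_left _ (Nat.succ_pos n))
  have f1 : n * (k * k) ≤ M * (M * M) := Nat.mul_le_mul hn (Nat.mul_le_mul hk hk)
  have f2 : n * k ≤ M * M := Nat.mul_le_mul hn hk
  have f3 : n * n ≤ M * M := Nat.mul_le_mul hn hn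
  have f5 : M * M ≤ M * (M * M) := Nat.le_mul_of_pos_left _ hM1
  have f6 : M ≤ M * (M * M) := Nat.le_mul_of_pos_right _ (Nat.mul_pos hM1 hM1)
  have f7 : 1 ≤ M * (M * M) := Nat.mul_pos hM1 (Nat.mul_pos hM1 hM1)
  have h3 : M * (M * M) ≤ M ^ 16 := by
    rw [← pow_three]
    exact Nat.pow_le_pow_right hM1 (by norm_num)
  nlinarith [f1, f2, f3, f5, f6, f7, h3, hn]

/-! ### Semantics of the tests -/

/-- `OH` decides "every block has at least one and at most one true wire". [folklore] -/
theorem oneHotLt_oh_eq (n k : ℕ) (x : Fin n × Fin k → Bool) :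
    ((Finset.univ : Finset (Fin n)).toList.all fun j =>
        ((Finset.univ : Finset (Fin k)).toList.any fun i => x (j, i)) &&
        (Finset.univ : Finset (Fin k × Fin k)).toList.all fun ii =>
          decide (ii.1 = ii.2) || !(x (j, ii.1) && x (j, ii.2))) =
      decide (∀ j : Fin n, (∃ i : Fin k, x (j, i) = true) ∧
        ∀ i i' : Fin k, x (j, i) = true → x (j, i') = true → i = i') := by
  have hA : ∀ j : Fin n, (((Finset.univ : Finset (Fin k)).toList.any fun i => x (j, i)) = true) ↔
      ∃ i : Fin k, x (j, i) = true := fun j => by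
    rw [List.any_eq_true]
    simp only [Finset.mem_toList, Finset.mem_univ, true_and]
  have hE : ∀ j : Fin n, (((Finset.univ : Finset (Fin k × Fin k)).toList.all fun ii =>
      decide (ii.1 = ii.2) || !(x (j, ii.1) && x (j, ii.2))) = true) ↔
      ∀ i i' : Fin k, x (j, i) = true → x (j, i') = true → i = i' := fun j => by
    rw [List.all_eq_true]
    simp only [Finset.mem_toList, Finset.mem_univ, true_implies, Prod.forall]
    refine forall_congr' fun i => forall_congr' fun i' => ?_
    cases x (j, i) <;> cases x (j, i') <;> simp
  rw [Bool.eq_iff_iff, decide_eq_true_iff, List.all_eq_true]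
  simp only [Finset.mem_toList, Finset.mem_univ, true_implies, Bool.and_eq_true, hA, hE]

/-- From `OH x = true`, `x` is the one-hot encoding of a digit vector. [folklore] -/
theorem oneHotLt_oh_sound (n k : ℕ) (x : Fin n × Fin k → Bool)
    (h : ((Finset.univ : Finset (Fin n)).toList.all fun j =>
        ((Finset.univ : Finset (Fin k)).toList.any fun i => x (j, i)) &&
        (Finset.univ : Finset (Fin k × Fin k)).toList.all fun ii =>
          decide (ii.1 = ii.2) || !(x (j, ii.1) && x (j, ii.2))) = true) :
    ∃ d : Fin n → Fin k, x = fun v => decide (d v.1 = v.2) := by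
  rw [oneHotLt_oh_eq n k x, decide_eq_true_iff] at h
  choose d hd using fun j => (h j).1
  refine ⟨d, funext fun v => ?_⟩
  obtain ⟨j, i⟩ := v
  dsimp only
  cases hji : x (j, i)
  · symm
    rw [decide_eq_false_iff_not]
    rintro rfl
    exact absurd (hji.symm.trans (hd j)) Bool.false_ne_true
  · exact (decide_eq_true ((h j).2 _ _ (hd j) hji)).symm

/-- `LEX` decides "some block `j` has a true wire below `c j` and every later block has its
`c`-wire true". [folklore] -/
theorem oneHotLt_lex_eq (n k : ℕ) (c : Fin n → Fin k) (x : Fin n × Fin k → Bool) :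
    ((Finset.univ : Finset (Fin n)).toList.any fun j =>
        ((Finset.univ.filter fun i : Fin k => i < c j).toList.any fun i => x (j, i)) &&
        (Finset.univ.filter fun j' : Fin n => j < j').toList.all fun j' => x (j', c j')) =
      decide (∃ j : Fin n, (∃ i : Fin k, i < c j ∧ x (j, i) = true) ∧
        ∀ j' : Fin n, j < j' → x (j', c j') = true) := by
  rw [Bool.eq_iff_iff, decide_eq_true_iff, List.any_eq_true]
  simp only [Finset.mem_toList, Finset.mem_univ, true_and, Bool.and_eq_true, List.any_eq_true,
    List.all_eq_true, Finset.mem_filter]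

/-! ### The stub -/

/-- **Stub C2 (`stub_oneHotLtCircuit`) of line `sml-polarised-transport`.** There is a constant `c`
(`c = 16`) such that for `2 ≤ k`, `1 ≤ n`, `p < k ^ n` some `B₂`-circuit `G` of size
`≤ c · ((n+1)(k+1))^c` on inputs `Fin n × Fin k` accepts only one-hot digit vectors and, on the
one-hot encoding of `d : Fin n → Fin k`, decides `Σ_j d_j k^j < p`. [folklore] -/
theorem stub_oneHotLtCircuit :
    ∃ c : ℕ, ∀ (k n p : ℕ), 2 ≤ k → 1 ≤ n → p < k ^ n →
      ∃ G : ((Fin n × Fin k) → Bool) → Unit → Bool,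
        CktSize B2 G (c * ((n + 1) * (k + 1)) ^ c) ∧
        (∀ x, G x () = true → ∃ d : Fin n → Fin k, x = fun v => decide (d v.1 = v.2)) ∧
        ∀ d : Fin n → Fin k, G (fun v => decide (d v.1 = v.2)) () =
          decide (∑ j : Fin n, (d j : ℕ) * k ^ (j : ℕ) < p) := by
  refine ⟨16, fun k n p _ _ hp => ?_⟩
  obtain ⟨pd, hpd⟩ : ∃ pd : Fin n → Fin k, ∑ j : Fin n, (pd j : ℕ) * k ^ (j : ℕ) = p :=
    ⟨finFunctionFinEquiv.symm ⟨p, hp⟩, by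
      rw [← finFunctionFinEquiv_apply, Equiv.apply_symm_apply]⟩
  have hG := ((oneHotLt_andVia (oneHotLt_ohVia n k) (oneHotLt_lexVia n k pd)).toCktSize).of_le
    (oneHotLt_cost_le n k)
  refine ⟨_, hG, fun x hx => ?_, fun d => ?_⟩
  · rw [Bool.and_eq_true] at hx
    exact oneHotLt_oh_sound n k x hx.1
  · have h1 := oneHotLt_oh_eq n k fun v => decide (d v.1 = v.2)
    have h2 := oneHotLt_lex_eq n k pd fun v => decide (d v.1 = v.2)
    rw [h1, h2, Bool.eq_iff_iff]
    simp only [Bool.and_eq_true, decide_eq_true_eq]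
    rw [← hpd, oneHotLt_lex_iff]
    simp only [exists_eq_right']
    exact ⟨fun h => h.2, fun h => ⟨fun j => ⟨⟨d j, rfl⟩, fun i i' hi hi' => hi.symm.trans hi'⟩, h⟩⟩

end Summit.ValiantsHypothesis.ValiantsHypothesis.Theorems.FeketeSOSSOSMagnification
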